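import Summits.AtomisticToContinuum.Crystallization.Theses.SpectralChargeLedger
import Summits.AtomisticToContinuum.Crystallization.Theorems.PhononSlackCertificatesCoerciveTwoShellGapBlocks

/-!
# Crux `SpectralChargeLedger.SummedShellPricing` (K1, stmt-AtomisticToContinuum-17044), line `Sketch`,
# skeleton v2 — stub `stub_spoiledByGross`: the spoiled-by-gross packing lemma

This file is stub `stub_spoiledByGross` of line `Sketch` (skeleton v2,
`Cruxes/SummedShellPricing/Lines/Sketch.lean`) for crux stmt-AtomisticToContinuum-17044; it feeds
`hcpRelativeLedger_of` there.  It is pure bookkeeping on periodic configurations (no potential, no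
energy): for every depth `R > 0` there is `K ≥ 0` — here `K = (2R/(1/3) + 1)³ = (6R + 1)³` — such that
in every periodic `P` with `1/3`-separated points the number of motif sites within distance `R` of
SOME `1/20`-two-shell-bad point of `P.points` is at most `K` times the number of two-shell-bad MOTIF
sites.

Proof.  A bad point `p = g + λ` (`g ∈ motif`, `λ ∈ lattice`) has a bad representative `g`, because set
goodness is invariant under the period lattice
(`CoerciveTwoShellGapBlocks.isTwoShellGoodSet_add_iff`).  For fixed `g` the motif sites `q` with
`dist (g + λ) q ≤ R` for some period `λ` inject into `P.points ∩ B̄_R(g)` by `q ↦ q − λ_q` (distinct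
motif points are inequivalent modulo the lattice, `PeriodicConfiguration.eq_of_sub_mem`), and that
finite set (`PeriodicConfiguration.finite_inter_points`) has at most `(2R/(1/3) + 1)³` points by the
volume packing bound `card_le_of_separated_of_dist_le` (`translates_card_le`).  Summing over the bad
motif sites (`Finset.card_biUnion_le`) gives the claim.

Not here: anything about energies, the interior ledger (`stub_interiorLedgerAt`) or the hub crux.
-/

noncomputable section

namespace Summit.AtomisticToContinuum.Crystallization.Theorems.SummedShellPricingSpoiledByGross

open scoped BigOperators Classical
open Literature.MathematicalPhysics.StatisticalMechanics Literature.Geometry.DiscreteGeometry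

/-- **Translates into a ball.**  For a periodic `P` with `1/3`-separated points, a centre `g` and a
radius `R ≥ 0`, the motif sites `q` with `dist (g + λ) q ≤ R` for some period `λ` number at most
`(2R/(1/3) + 1)³`: `q ↦ q − λ_q` injects them into the finite set `P.points ∩ B̄_R(g)` (distinct
motif points are inequivalent modulo the lattice), which obeys the volume packing bound for
`1/3`-separated points in a ball of `ℝ³`. [folklore] -/
theorem translates_card_le (P : PeriodicConfiguration 3)
    (hsep : ∀ u ∈ P.points, ∀ v ∈ P.points, u ≠ v → (1 / 3 : ℝ) ≤ dist u v)
    (g : EuclideanSpace ℝ (Fin 3)) {R : ℝ} (hR : 0 ≤ R) :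
    ((P.motif.filter fun q => ∃ l ∈ P.lattice, dist (g + l) q ≤ R).card : ℝ)
      ≤ (2 * R / (1 / 3) + 1) ^ 3 := by
  set T := P.motif.filter fun q => ∃ l ∈ P.lattice, dist (g + l) q ≤ R with hT
  -- the finite set of points of `P` in the closed ball about `g`
  have hfin : (Metric.closedBall g R ∩ P.points).Finite :=
    P.finite_inter_points Metric.isBounded_closedBall
  set S := hfin.toFinset with hS
  -- a period for each site of `T`
  have hchoice : ∀ q ∈ T, ∃ l ∈ P.lattice, dist (g + l) q ≤ R := fun q hq =>
    (Finset.mem_filter.1 hq).2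
  choose! l hl hdl using hchoice
  -- `q ↦ q - l q` maps `T` into `S` …
  have hmaps : Set.MapsTo (fun q => q - l q) (T : Set (EuclideanSpace ℝ (Fin 3))) S := by
    intro q hq
    have hqT : q ∈ T := hq
    have hqm : q ∈ P.motif := (Finset.mem_filter.1 hqT).1
    rw [hS, Set.Finite.coe_toFinset]
    refine ⟨?_, ?_⟩
    · rw [Metric.mem_closedBall]
      have : dist (q - l q) g = dist (g + l q) q := by
        rw [dist_eq_norm, dist_eq_norm, ← norm_neg]
        congr 1
        abel
      rw [this]
      exact hdl q hqT
    · simpa [sub_eq_add_neg] using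
        P.add_mem_points (P.mem_points_of_mem_motif hqm) (P.lattice.neg_mem (hl q hqT))
  -- … injectively (distinct motif points are inequivalent modulo the lattice)
  have hinj : Set.InjOn (fun q => q - l q) (T : Set (EuclideanSpace ℝ (Fin 3))) := by
    intro q hq q' hq' hqq'
    have hqT : q ∈ T := hq
    have hq'T : q' ∈ T := hq'
    have hqm : q ∈ P.motif := (Finset.mem_filter.1 hqT).1
    have hq'm : q' ∈ P.motif := (Finset.mem_filter.1 hq'T).1
    refine P.eq_of_sub_mem q hqm q' hq'm ?_
    have h' : q - l q = q' - l q' := hqq'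
    rw [sub_eq_sub_iff_sub_eq_sub] at h'
    rw [h']
    exact P.lattice.sub_mem (hl q hqT) (hl q' hq'T)
  have h1 : T.card ≤ S.card := Finset.card_le_card_of_injOn _ hmaps hinj
  -- packing bound in the ball
  have h2 : (S.card : ℝ) ≤ (2 * R / (1 / 3) + 1) ^ Module.finrank ℝ (EuclideanSpace ℝ (Fin 3)) := by
    refine card_le_of_separated_of_dist_le S g (by norm_num) hR ?_ ?_
    · intro c hc
      rw [hS, Set.Finite.mem_toFinset] at hc
      exact Metric.mem_closedBall.1 hc.1
    · intro c hc d hd hcd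
      rw [hS, Set.Finite.mem_toFinset] at hc hd
      exact hsep c hc.2 d hd.2 hcd
  rw [finrank_euclideanSpace_fin] at h2
  calc (T.card : ℝ) ≤ S.card := by exact_mod_cast h1
    _ ≤ _ := h2

/-- **Stub `stub_spoiledByGross` — SPOILED-BY-GROSS PACKING LEMMA** (line `Sketch`, skeleton v2, of crux
stmt-AtomisticToContinuum-17044; pure geometry of periodic configurations).  For every depth `R > 0`
there is `K ≥ 0` (namely `K = (6R + 1)³`) such that in every periodic `P` with `1/3`-separated points
the number of motif sites within distance `R` of SOME two-shell-bad point of `P.points` is at most `K`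
times the number of two-shell-bad MOTIF sites: a bad point `p = g + λ` has a bad motif representative
`g` (lattice invariance of set goodness), and for fixed `g` at most `(6R + 1)³` motif sites have a
period translate of `g` within `R` (`translates_card_le`). [folklore] -/
theorem stub_spoiledByGross :
    ∀ R : ℝ, 0 < R → ∃ K : ℝ, 0 ≤ K ∧
      ∀ P : PeriodicConfiguration 3, (∀ u ∈ P.points, ∀ v ∈ P.points, u ≠ v → (1 / 3 : ℝ) ≤ dist u v) →
        ((P.motif.filter fun q =>
            ∃ p ∈ P.points, dist p q ≤ R ∧ ¬ IsTwoShellGoodSet (1 / 20) (47 / 50) 1 P.points p).card : ℝ)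
          ≤ K * ((P.motif.filter fun q => ¬ IsTwoShellGoodSet (1 / 20) (47 / 50) 1 P.points q).card : ℝ) := by
  intro R hR
  refine ⟨(2 * R / (1 / 3) + 1) ^ 3, by positivity, ?_⟩
  intro P hsep
  set K : ℝ := (2 * R / (1 / 3) + 1) ^ 3 with hK
  set Sp := P.motif.filter fun q =>
      ∃ p ∈ P.points, dist p q ≤ R ∧ ¬ IsTwoShellGoodSet (1 / 20) (47 / 50) 1 P.points p with hSp
  set Bad := P.motif.filter fun q => ¬ IsTwoShellGoodSet (1 / 20) (47 / 50) 1 P.points q with hBad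
  set T : EuclideanSpace ℝ (Fin 3) → Finset (EuclideanSpace ℝ (Fin 3)) := fun g =>
      P.motif.filter fun q => ∃ l ∈ P.lattice, dist (g + l) q ≤ R with hT
  -- every spoiled site has a period translate of a bad MOTIF site within `R`
  have hsub : Sp ⊆ Bad.biUnion T := by
    intro q hq
    rw [hSp, Finset.mem_filter] at hq
    obtain ⟨hqm, p, hp, hpq, hbad⟩ := hq
    obtain ⟨y, hy, l, hl, rfl⟩ := hp
    rw [Finset.mem_biUnion]
    refine ⟨y, ?_, ?_⟩
    · rw [hBad, Finset.mem_filter]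
      exact ⟨hy, fun hgood =>
        hbad ((CoerciveTwoShellGapBlocks.isTwoShellGoodSet_add_iff P hl y).2 hgood)⟩
    · simp only [hT, Finset.mem_filter]
      exact ⟨hqm, l, hl, hpq⟩
  have hTle : ∀ g ∈ Bad, ((T g).card : ℝ) ≤ K := fun g _ =>
    translates_card_le P hsep g hR.le
  calc (Sp.card : ℝ) ≤ ((Bad.biUnion T).card : ℝ) := by exact_mod_cast Finset.card_le_card hsub
    _ ≤ ((∑ g ∈ Bad, (T g).card : ℕ) : ℝ) := by exact_mod_cast Finset.card_biUnion_le
    _ = ∑ g ∈ Bad, ((T g).card : ℝ) := by push_cast; rfl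
    _ ≤ ∑ g ∈ Bad, K := Finset.sum_le_sum hTle
    _ = K * Bad.card := by rw [Finset.sum_const, nsmul_eq_mul, mul_comm]

end Summit.AtomisticToContinuum.Crystallization.Theorems.SummedShellPricingSpoiledByGross

end
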